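import Mathlib
import HarnessLib
import Summits.HubbardSuperconductivity.HubbardSuperconductivity.Theorems.KLProgrammeKLRegimeEngineTowerLevUnitsDefs
import Summits.HubbardSuperconductivity.HubbardSuperconductivity.Theorems.KLProgrammeKLRegimeEngineTowerRemeasureLevUniform

/-!
# Route `KLProgramme` — crux K3 ENGINE (stmt-HubbardSuperconductivity-20437 `KLRegimeEngineV17F2`), stub (b) v2, THE LEVELS PACKAGE (ℓ), instantiation (I2):
# THE LEVELLED RE-MEASUREMENT ROW IN KIT UNITS — the `hμ` summands of `towerBorn_le_law_tracks` for the tracks `F ≥ 2`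
# (located item «(I2)-KIT-HMU-LEV», UNITS-MAP §(1)–(3), k3c2-p3 g12 verdict PASS; E1 blueprint §6 step 3 `…EngineTowerInstRemeasure`, levelled track;
#  cell gate-hubbard-kl, seat p4 g17 — E1's booking by the (R136) substitute precedent)

Divide the m-uniform summed row `klTowerMeasLev_le_uv_add_sum_bornLev_klEng_lastLeg_uniform` (…RemeasureLevUniform) by the track unit
`klLevUnit β M t p (dk−1)` (…LevUnitsDefs).  Pure bookkeeping on powers of `√2` turns the absolute jump factor `(2^{dk−1−dk′})^{2p−1−F}` into the kit's rate
form: with `r := ((√2)^d)⁻¹` (`= √g`), `a_t = 2`, `bo_t = 6 − t` (`F = t + 1`),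
`summand_{k′} / unit_t(p, dk−1) = C·(√2)^{2p+t−6}·r^{(2p+t−6)(k−k′)}·klTowerBLev … d t (k′+1) p` — admissible for the kit (`bo_t + 1 ≤ 3a_t`) exactly when
`t ≥ 1`: the one-determined-leg count closes `hμ` for the four tracks `F = 2 … 5`; the track `F = 1` needs the off/on-class split (next file).

* §1 `two_pow_eq_sqrt_two_pow`, `klLevRatio_jump_identity` (`2^{2p−2−t}·32·(√2)^t·(√2)^{2p+t−6} = 8^p`), `jump_div_klLevRatio_eq` (`2^{2p−2−t}/klLevRatio t p = ((√2)^{2p+t−6})⁻¹`),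
  `bornSummand_div_klLevUnit_eq` (the rate form of one born summand), `uvSummand_div_klLevUnit_eq`;
* §2 **`klTowerMuLevAt_le_kitSum`** — for `t : Fin 5`, `3 ≤ p`, under the binders of the uniform row:
  `klTowerMuLevAt … d t k p ≤ 27^{t+1}·C₁C₂^{2p−1}·( ((√2)^{2p+t−6})⁻¹^{dk−1}·N₀/unit_t(p,0) + Σ_{k′<k} (√2)^{2p+t−6}·r^{(2p+t−6)(k−k′)}·klTowerBLev … d t (k′+1) p )`.
Compositions of landed theorems and real algebra; nothing about the model is asserted beyond them; nothing asserts (ℓ), any stub, K3 or superconductivity.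
References: BGM 2006 §2.8 (2.83), (2.93)–(2.98) [cite: BenfattoGiulianiMastropietro2006].
-/

noncomputable section

namespace Summit.HubbardSuperconductivity.HubbardSuperconductivity.Theorems.EngineV8

set_option linter.dupNamespace false -- summit = problem name (single-conjunct summit), D-0017

open Classical
open Real Finset Literature.MathematicalPhysics.QuantumLattice Literature.Probability.LatticeModels GrassmannAlgebra
open Literature.MathematicalPhysics.QuantumLattice.FermiRG
open Summit.HubbardSuperconductivity.HubbardSuperconductivity.Theorems.KLProgrammeLegKernels
open Summit.HubbardSuperconductivity.HubbardSuperconductivity.Theorems.KLRegimeSplit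
open Summit.HubbardSuperconductivity.HubbardSuperconductivity.Theorems.KLRegimeWick
open Summit.HubbardSuperconductivity.HubbardSuperconductivity.Theorems.TorusFourierL2
open Summit.HubbardSuperconductivity.HubbardSuperconductivity.Theorems.DispersionFlow
open Summit.HubbardSuperconductivity.HubbardSuperconductivity.Theorems.PerturbedFermiCurve

/-! ## §1 Powers of `√2`: the jump factor against the unit ratio -/

/-- `2^n = (√2)^{2n}`. -/
theorem two_pow_eq_sqrt_two_pow (n : ℕ) : (2 : ℝ) ^ n = Real.sqrt 2 ^ (2 * n) := by
  rw [pow_mul, Real.sq_sqrt (by norm_num : (0 : ℝ) ≤ 2)]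

/-- **The jump/unit identity**: `2^{2p−2−t}·32·(√2)^t·(√2)^{2p+t−6} = 8^p` for `t + 2 ≤ 2p` and `6 ≤ 2p + t`. -/
theorem klLevRatio_jump_identity {p t : ℕ} (h1 : t + 2 ≤ 2 * p) (h2 : 6 ≤ 2 * p + t) :
    (2 : ℝ) ^ (2 * p - 2 - t) * 32 * Real.sqrt 2 ^ t * Real.sqrt 2 ^ (2 * p + t - 6) = 8 ^ p := by
  have h32 : (32 : ℝ) = Real.sqrt 2 ^ 10 := by
    rw [show (10 : ℕ) = 2 * 5 by norm_num, ← two_pow_eq_sqrt_two_pow]; norm_num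
  have h8 : (8 : ℝ) ^ p = Real.sqrt 2 ^ (6 * p) := by
    rw [show 6 * p = 2 * (3 * p) by ring, ← two_pow_eq_sqrt_two_pow, pow_mul]; norm_num
  rw [two_pow_eq_sqrt_two_pow, h32, h8, ← pow_add, ← pow_add, ← pow_add]
  congr 1; omega

/-- **The jump factor over the unit ratio is a pure gain**: `2^{2p−2−t} / klLevRatio t p = ((√2)^{2p+t−6})⁻¹` (`t + 2 ≤ 2p`, `6 ≤ 2p + t`). -/
theorem jump_div_klLevRatio_eq {p : ℕ} (t : Fin 5) (h1 : (t : ℕ) + 2 ≤ 2 * p) (h2 : 6 ≤ 2 * p + (t : ℕ)) :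
    (2 : ℝ) ^ (2 * p - 2 - (t : ℕ)) / klLevRatio t p = (Real.sqrt 2 ^ (2 * p + (t : ℕ) - 6))⁻¹ := by
  have hs : 0 < Real.sqrt 2 := Real.sqrt_pos.2 (by norm_num)
  have hid := klLevRatio_jump_identity h1 h2
  unfold klLevRatio
  have h8 : (0 : ℝ) < 8 ^ p := by positivity
  have hst : 0 < Real.sqrt 2 ^ (t : ℕ) := by positivity
  have hsb : 0 < Real.sqrt 2 ^ (2 * p + (t : ℕ) - 6) := by positivity
  field_simp
  linear_combination hid

/-- The rate form of a reciprocal power: `(x⁻¹)^{Δ} = x·(x⁻¹)^{Δ+1}` for `x ≠ 0`. -/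
theorem inv_pow_eq_mul_inv_pow_succ {x : ℝ} (hx : x ≠ 0) (Δ : ℕ) : x⁻¹ ^ Δ = x * x⁻¹ ^ (Δ + 1) := by
  rw [pow_succ]; field_simp

variable {L M : ℕ} [NeZero L] [NeZero M]

/-- **One born summand in kit units, rate form**: for `k′ < k`, `1 ≤ d`, `F = t + 1`, `t + 2 ≤ 2p`, `6 ≤ 2p + t`,
`(2^{dk−1−dk′})^{2p−1−F}·klTowerBornLev … d k′ (2p) F / klLevUnit … t p (dk−1) = (√2)^{2p+t−6}·(((√2)^d)⁻¹)^{(2p+t−6)(k−k′)}·klTowerBLev … d t (k′+1) p`. -/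
theorem bornSummand_div_klLevUnit_eq {β : ℝ} (hβ : 0 < β) (U μ : ℝ) (K : TrigPolyC4v) {d k k' p : ℕ} (hd : 1 ≤ d) (hk : k' < k)
    (t : Fin 5) (h1 : (t : ℕ) + 2 ≤ 2 * p) (h2 : 6 ≤ 2 * p + (t : ℕ)) :
    ((2 : ℝ) ^ (d * k - 1 - d * k')) ^ (2 * p - 1 - ((t : ℕ) + 1)) * klTowerBornLev L M β U μ K d k' (2 * p) ((t : ℕ) + 1) /
        klLevUnit β M t p (d * k - 1) =
      Real.sqrt 2 ^ (2 * p + (t : ℕ) - 6) * ((Real.sqrt 2 ^ d)⁻¹) ^ ((2 * p + (t : ℕ) - 6) * (k - k')) *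
        klTowerBLev L M β U μ K d t (k' + 1) p := by
  have hs : 0 < Real.sqrt 2 := Real.sqrt_pos.2 (by norm_num)
  have hu0 : 0 < klLevUnit β M t p (d * k') := klLevUnit_pos hβ t p _
  have hr0 : 0 < klLevRatio t p := klLevRatio_pos t p
  -- the jump `Δ = dk − 1 − dk′` and `Δ + 1 = d(k − k′)`
  obtain ⟨Δ, hΔ⟩ : ∃ Δ : ℕ, d * k - 1 = d * k' + Δ := ⟨d * k - 1 - d * k', by
    have : d * k' + d ≤ d * k := by rw [← Nat.mul_succ]; exact Nat.mul_le_mul_left d hk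
    omega⟩
  have hΔ1 : Δ + 1 = d * (k - k') := by
    have : d * (k - k') = d * k - d * k' := Nat.mul_sub d k k'
    have : d * k' + d ≤ d * k := by rw [← Nat.mul_succ]; exact Nat.mul_le_mul_left d hk
    omega
  have hΔ' : d * k - 1 - d * k' = Δ := by omega
  rw [hΔ', hΔ, klLevUnit_add, klTowerBLev_succ, show 2 * p - 1 - ((t : ℕ) + 1) = 2 * p - 2 - (t : ℕ) by omega, ← pow_mul,
    mul_comm Δ, pow_mul]
  rw [show ((2 : ℝ) ^ (2 * p - 2 - (t : ℕ))) ^ Δ * klTowerBornLev L M β U μ K d k' (2 * p) ((t : ℕ) + 1) /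
      (klLevUnit β M t p (d * k') * klLevRatio t p ^ Δ) =
      ((2 : ℝ) ^ (2 * p - 2 - (t : ℕ)) / klLevRatio t p) ^ Δ * (klTowerBornLev L M β U μ K d k' (2 * p) ((t : ℕ) + 1) / klLevUnit β M t p (d * k')) by
    rw [div_pow]; field_simp]
  rw [jump_div_klLevRatio_eq t h1 h2, inv_pow_eq_mul_inv_pow_succ (by positivity) Δ, hΔ1, ← inv_pow, ← pow_mul, ← inv_pow, ← pow_mul]
  congr 3
  ring

omit [NeZero L] in
/-- **The UV summand in kit units**: `(2^{dk−1})^{2p−1−F}·N₀ / klLevUnit … t p (dk−1) = ((√2)^{2p+t−6})⁻¹^{dk−1}·(N₀ / klLevUnit … t p 0)`. -/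
theorem uvSummand_div_klLevUnit_eq {β : ℝ} (hβ : 0 < β) {d k p : ℕ} (t : Fin 5) (h1 : (t : ℕ) + 2 ≤ 2 * p) (h2 : 6 ≤ 2 * p + (t : ℕ)) (N₀ : ℝ) :
    ((2 : ℝ) ^ (d * k - 1)) ^ (2 * p - 1 - ((t : ℕ) + 1)) * N₀ / klLevUnit β M t p (d * k - 1) =
      (Real.sqrt 2 ^ (2 * p + (t : ℕ) - 6))⁻¹ ^ (d * k - 1) * (N₀ / klLevUnit β M t p 0) := by
  have hu0 : 0 < klLevUnit β M t p 0 := klLevUnit_pos hβ t p _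
  have hr0 : 0 < klLevRatio t p := klLevRatio_pos t p
  rw [show d * k - 1 = 0 + (d * k - 1) by ring, klLevUnit_add, Nat.zero_add, show 2 * p - 1 - ((t : ℕ) + 1) = 2 * p - 2 - (t : ℕ) by omega,
    ← pow_mul, mul_comm (d * k - 1), pow_mul, ← jump_div_klLevRatio_eq t h1 h2, div_pow]
  field_simp

/-! ## §2 The levelled re-measurement row in kit units, tracks `F ≥ 2` (and `F = 1` off the six-leg cell) -/

omit [NeZero L] [NeZero M] in
/-- **THE `hμ` SUMMANDS OF THE LEVELLED TRACK IN KIT UNITS** (one-determined-leg count for every summand): `C₁, C₂` and the thresholds fixed BEFORE the degree; for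
every track `t : Fin 5` and half-degree `p` with `t + 2 ≤ 2p`, `6 ≤ 2p + t` (every `p ≥ 3`; `p = 2` for `t ≥ 2`), `d ≥ 2`, `k ≥ 1`, `dk − 1 ≤ nScales β + 1`, and
every bound `N₀` of the level-0 carriers of level `t + 1` in degree `2p`:
`klTowerMuLevAt … d t k p ≤ 27^{t+1}·C₁·C₂^{2p−1}·( ((√2)^{2p+t−6})⁻¹^{dk−1}·N₀/unit_t(p,0) + Σ_{k′<k} (√2)^{2p+t−6}·(((√2)^d)⁻¹)^{(2p+t−6)(k−k′)}·klTowerBLev … d t (k′+1) p )`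
— the kit's rate `r = (√2)^{−d} = √g`, `a_t = 2`, `bo_t = 6 − t`. [cite: BenfattoGiulianiMastropietro2006, §2.8 (2.83), (2.93)-(2.98)] -/
theorem klTowerMuLevAt_le_kitSum :
    ∃ C₁ C₂ : ℝ, 0 < C₁ ∧ 0 < C₂ ∧ ∀ R : RenConsts, R.WF2 → ∃ c₃' : ℝ, 0 < c₃' ∧ ∃ U₀' : ℝ, 0 < U₀' ∧
      ∀ (P : SplitConsts) (c : ℝ), P.WF → 0 < c → c ≤ klEngC₃6 P R → c ≤ c₃' →
      ∀ μ ∈ klWindowC, ∀ U : ℝ, 0 < U → U ≤ klEngU₀9 P R c → U ≤ U₀' → ∀ β : ℝ, klBetaMin ≤ β → β ≤ Real.exp (c / U ^ 2) →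
      ∀ K : TrigPolyC4v, FrameOK R U (nScales β) μ K → ∀ (L M : ℕ) [NeZero L] [NeZero M],
      klEngL₃ β U ≤ L → klEngM₃ β U L ≤ M → ∀ d k : ℕ, 2 ≤ d → 1 ≤ k → d * k - 1 ≤ nScales β + 1 →
      ∀ (t : Fin 5) (p : ℕ), (t : ℕ) + 2 ≤ 2 * p → 6 ≤ 2 * p + (t : ℕ) → ∀ N₀ : ℝ, 0 ≤ N₀ →
        (∀ Ωe' : Fin (2 * p) → Option (SectorLeg (sectorCount 0)), levelCount Ωe' = (t : ℕ) + 1 →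
          klAnisoLegKernelNormAt L M β U μ K klE0 0 (2 * p) Ωe' ≤ N₀) →
        klTowerMuLevAt L M β U μ K d t k p ≤
          (27 : ℝ) ^ ((t : ℕ) + 1) * (C₁ * C₂ ^ (2 * p - 1)) *
            ((Real.sqrt 2 ^ (2 * p + (t : ℕ) - 6))⁻¹ ^ (d * k - 1) * (N₀ / klLevUnit β M t p 0) +
              ∑ k' ∈ range k, Real.sqrt 2 ^ (2 * p + (t : ℕ) - 6) * ((Real.sqrt 2 ^ d)⁻¹) ^ ((2 * p + (t : ℕ) - 6) * (k - k')) *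
                klTowerBLev L M β U μ K d t (k' + 1) p) := by
  obtain ⟨C₁, C₂, hC₁, hC₂, h⟩ := klTowerMeasLev_le_uv_add_sum_bornLev_klEng_lastLeg_uniform
  refine ⟨C₁, C₂, hC₁, hC₂, fun R hR2 => ?_⟩
  obtain ⟨c₃, hc₃, U₀, hU₀, h'⟩ := h R hR2
  refine ⟨c₃, hc₃, U₀, hU₀, ?_⟩
  intro P c hP hc hc6 hc₃' μ hμ U hU hU9 hU₀' β hβmin hβc K hK L M _ _ hL3 hM3 d k hd hk1 hkN t p h1 h2 N₀ hN0 hN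
  have hβ : 0 < β := KLRegimeSplit.pos_of_klBetaMin_le hβmin
  have hp1 : 1 ≤ 2 * p := by omega
  have hu : 0 < klLevUnit β M t p (d * k - 1) := klLevUnit_pos hβ t p _
  -- the absolute row at `m + 1 = 2p` legs, level `F = t + 1`
  have hN' : ∀ Ωe' : Fin (2 * p - 1 + 1) → Option (SectorLeg (sectorCount 0)), levelCount Ωe' = (t : ℕ) + 1 →
      klAnisoLegKernelNormAt L M β U μ K klE0 0 (2 * p - 1 + 1) Ωe' ≤ N₀ := by
    rw [show 2 * p - 1 + 1 = 2 * p by omega]; exact hN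
  have hrow := h' (2 * p - 1) P c hP hc hc6 hc₃' μ hμ U hU hU9 hU₀' β hβmin hβc K hK L M hL3 hM3 d k hd hk1 hkN ((t : ℕ) + 1) N₀ hN0 hN'
  rw [show 2 * p - 1 + 1 = 2 * p by omega] at hrow
  -- divide by the unit and convert every summand
  unfold klTowerMuLevAt
  rw [div_le_iff₀ hu]
  have hborn : ∀ k' ∈ range k, C₁ * C₂ ^ (2 * p - 1) * ((2 : ℝ) ^ (d * k - 1 - d * k')) ^ (2 * p - 1 - ((t : ℕ) + 1)) *
      klTowerBornLev L M β U μ K d k' (2 * p) ((t : ℕ) + 1) =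
      C₁ * C₂ ^ (2 * p - 1) * (Real.sqrt 2 ^ (2 * p + (t : ℕ) - 6) * ((Real.sqrt 2 ^ d)⁻¹) ^ ((2 * p + (t : ℕ) - 6) * (k - k')) *
        klTowerBLev L M β U μ K d t (k' + 1) p) * klLevUnit β M t p (d * k - 1) := by
    intro k' hk'
    rw [mem_range] at hk'
    have e := bornSummand_div_klLevUnit_eq (L := L) (M := M) hβ U μ K (by omega : 1 ≤ d) hk' t h1 h2 (p := p)
    rw [div_eq_iff hu.ne'] at e
    rw [mul_assoc (C₁ * C₂ ^ (2 * p - 1)), mul_assoc (C₁ * C₂ ^ (2 * p - 1)), e]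
  have huv : C₁ * C₂ ^ (2 * p - 1) * ((2 : ℝ) ^ (d * k - 1)) ^ (2 * p - 1 - ((t : ℕ) + 1)) * N₀ =
      C₁ * C₂ ^ (2 * p - 1) * ((Real.sqrt 2 ^ (2 * p + (t : ℕ) - 6))⁻¹ ^ (d * k - 1) * (N₀ / klLevUnit β M t p 0)) *
        klLevUnit β M t p (d * k - 1) := by
    have e := uvSummand_div_klLevUnit_eq (M := M) hβ (d := d) (k := k) t h1 h2 N₀
    rw [div_eq_iff hu.ne'] at e
    rw [mul_assoc (C₁ * C₂ ^ (2 * p - 1)), mul_assoc (C₁ * C₂ ^ (2 * p - 1)), e]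
  rw [sum_congr rfl hborn, huv, ← sum_mul] at hrow
  have h27 : (1 : ℝ) ≤ (27 : ℝ) ^ ((t : ℕ) + 1) := one_le_pow₀ (by norm_num)
  have hS0 : 0 ≤ C₁ * C₂ ^ (2 * p - 1) * ((Real.sqrt 2 ^ (2 * p + (t : ℕ) - 6))⁻¹ ^ (d * k - 1) * (N₀ / klLevUnit β M t p 0)) +
      ∑ k' ∈ range k, C₁ * C₂ ^ (2 * p - 1) * (Real.sqrt 2 ^ (2 * p + (t : ℕ) - 6) * ((Real.sqrt 2 ^ d)⁻¹) ^ ((2 * p + (t : ℕ) - 6) * (k - k')) *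
        klTowerBLev L M β U μ K d t (k' + 1) p) := by
    have : 0 < klLevUnit β M t p 0 := klLevUnit_pos hβ t p 0
    refine add_nonneg (by positivity) (sum_nonneg fun k' _ => mul_nonneg (by positivity) (mul_nonneg (by positivity) ?_))
    exact klTowerBLev_nonneg hβ U μ K d t (k' + 1) p
  have hmeas0 : 0 ≤ klTowerMeasLev L M β U μ K d k (2 * p) ((t : ℕ) + 1) := klTowerMeasLev_nonneg hβ.le U μ K d k _ _
  calc (27 : ℝ) ^ ((t : ℕ) + 1) * klTowerMeasLev L M β U μ K d k (2 * p) ((t : ℕ) + 1)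
      ≤ (27 : ℝ) ^ ((t : ℕ) + 1) * ((C₁ * C₂ ^ (2 * p - 1) * ((Real.sqrt 2 ^ (2 * p + (t : ℕ) - 6))⁻¹ ^ (d * k - 1) * (N₀ / klLevUnit β M t p 0)) +
          ∑ k' ∈ range k, C₁ * C₂ ^ (2 * p - 1) * (Real.sqrt 2 ^ (2 * p + (t : ℕ) - 6) * ((Real.sqrt 2 ^ d)⁻¹) ^ ((2 * p + (t : ℕ) - 6) * (k - k')) *
            klTowerBLev L M β U μ K d t (k' + 1) p)) * klLevUnit β M t p (d * k - 1)) := by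
        refine mul_le_mul_of_nonneg_left ?_ (by positivity)
        rw [add_mul]; exact hrow
    _ = (27 : ℝ) ^ ((t : ℕ) + 1) * (C₁ * C₂ ^ (2 * p - 1)) *
          ((Real.sqrt 2 ^ (2 * p + (t : ℕ) - 6))⁻¹ ^ (d * k - 1) * (N₀ / klLevUnit β M t p 0) +
            ∑ k' ∈ range k, Real.sqrt 2 ^ (2 * p + (t : ℕ) - 6) * ((Real.sqrt 2 ^ d)⁻¹) ^ ((2 * p + (t : ℕ) - 6) * (k - k')) *
              klTowerBLev L M β U μ K d t (k' + 1) p) * klLevUnit β M t p (d * k - 1) := by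
        rw [← mul_sum]; ring

end Summit.HubbardSuperconductivity.HubbardSuperconductivity.Theorems.EngineV8

end
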